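import Summits.ABC.StewartYu.PadicW80Par3A
import HarnessLib

/-!
# The `q = 3` (`p = 2`) parameter record — part B: `T`, `L_θ`, `Lⱼ`, `J₀`, and `T ≥ 2¹¹ m² nV_θ L_θ`

Support file (theorems only; no named facts), cell `abc-stewartyu` (p1; crux `W80Two` stmt-ABC-19486; design memo
HOME/p1/S2-q3-record-design.md).  Base-`3` twin of the `T`/`L_θ`/`J₀` lemmas of `PadicW80ParLA/B`:
`1 ≤ T ≤ U/(c_T 3ᵐ W⋆)` (floor costs `≤ 1`), `T W⋆ ≤ 𝔘/c_T`, `1 ≤ L_θ < 3^{J₀} ≤ 3 L_θ`, `Lⱼ ≤ U/(c_L' m 3^{m+1} S₀ Vⱼ)`,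
`T ≥ 2¹¹ m² nV_θ L_θ`. Everything is [folklore] bookkeeping on [cite: Waldschmidt1980, §3.2 (3.2)–(3.14) (pp. 264–265)]
and [cite: Yu1989, §3].
-/

noncomputable section

open Finset Real

namespace Summit.ABC.StewartYu

open PadicW80Par (cTp cSp cLp cLp' Ap mRp)

namespace PadicW80ParL

variable {d : ℕ} (P : PadicW80ParL d)

/-! ### `T` -/

/-- `T ≤ U/(c_T 3ᵐ W⋆)`. [folklore] -/
theorem T3_le : (P.T3 : ℝ) ≤ P.Uℓ / (cTp * 3 ^ (d + 1) * P.Wstarℓ) := by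
  unfold T3
  exact Nat.floor_le (by unfold PadicW80Par.cTp; have := P.U_pos; have := P.one_le_Wstar; positivity)

/-- `U/(c_T 3ᵐ W⋆) ≥ 2`. [folklore] -/
theorem two_le_U_div_cT3 : (2 : ℝ) ≤ P.Uℓ / (cTp * 3 ^ (d + 1) * P.Wstarℓ) := by
  have h := P.𝔘3_ge_Wstar
  have hW := P.one_le_Wstar
  unfold PadicW80Par.cTp
  rw [le_div_iff₀ (by positivity), P.U_eq3]
  have h50 : (2 : ℝ) * 2 ^ 14 ≤ 2 ^ (48 * (d + 1)) := by
    calc (2 : ℝ) * 2 ^ 14 = 2 ^ 15 := by norm_num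
      _ ≤ 2 ^ (48 * (d + 1)) := pow_le_pow_right₀ (by norm_num) (by omega)
  calc (2 : ℝ) * (2 ^ 14 * 3 ^ (d + 1) * P.Wstarℓ) = 3 ^ (d + 1) * ((2 * 2 ^ 14) * P.Wstarℓ) := by ring
    _ ≤ 3 ^ (d + 1) * (2 ^ (48 * (d + 1)) * P.Wstarℓ) := by gcongr
    _ ≤ 3 ^ (d + 1) * P.𝔘3 := by gcongr

/-- `U/(2 c_T 3ᵐ W⋆) ≤ T` (the floor costs at most a factor `2`). [folklore] -/
theorem T3_ge : P.Uℓ / (cTp * 3 ^ (d + 1) * P.Wstarℓ) / 2 ≤ P.T3 := by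
  unfold T3
  have h1 := Nat.lt_floor_add_one (P.Uℓ / (cTp * 3 ^ (d + 1) * P.Wstarℓ))
  have h2 := P.two_le_U_div_cT3
  linarith

/-- `U/(c_T 3ᵐ W⋆) − 1 ≤ T` (the floor costs at most `1`). [folklore] -/
theorem T3_ge' : P.Uℓ / (cTp * 3 ^ (d + 1) * P.Wstarℓ) - 1 ≤ P.T3 := by
  unfold T3
  have h1 := Nat.lt_floor_add_one (P.Uℓ / (cTp * 3 ^ (d + 1) * P.Wstarℓ))
  linarith

/-- `1 ≤ T`. [folklore] -/
theorem one_le_T3 : 1 ≤ P.T3 := by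
  have h := P.T3_ge
  have h2 := P.two_le_U_div_cT3
  have : (1 : ℝ) ≤ P.T3 := by linarith
  exact_mod_cast this

/-- `0 < T` (real). [folklore] -/
theorem T3_pos : (0 : ℝ) < P.T3 := by have := P.one_le_T3; exact_mod_cast this

/-- **`T W⋆ ≤ 𝔘/c_T`.** [folklore] -/
theorem T3Wstar_le : (P.T3 : ℝ) * P.Wstarℓ ≤ P.𝔘3 / cTp := by
  have h := P.T3_le
  have hW := P.one_le_Wstar
  unfold cTp at *
  rw [P.U_eq3] at h
  rw [le_div_iff₀ (by positivity)] at h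
  rw [le_div_iff₀ (by norm_num)]
  have key : ((P.T3 : ℝ) * P.Wstarℓ * 2 ^ 14) * 3 ^ (d + 1) ≤ P.𝔘3 * 3 ^ (d + 1) := by
    calc ((P.T3 : ℝ) * P.Wstarℓ * 2 ^ 14) * 3 ^ (d + 1) = P.T3 * (2 ^ 14 * 3 ^ (d + 1) * P.Wstarℓ) := by ring
      _ ≤ 3 ^ (d + 1) * P.𝔘3 := h
      _ = P.𝔘3 * 3 ^ (d + 1) := by ring
  exact le_of_mul_le_mul_right key (by positivity)

/-- `T ≤ 𝔘/c_T`. [folklore] -/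
theorem T3_le_𝔘3 : (P.T3 : ℝ) ≤ P.𝔘3 / cTp := by
  have h := P.T3Wstar_le; have hW := P.one_le_Wstar
  have hT : (0 : ℝ) ≤ P.T3 := Nat.cast_nonneg _
  nlinarith

/-! ### `L_θ`, `Lⱼ`, `J₀` -/

/-- The denominator of `L_θ` is positive. [folklore] -/
theorem den_Lθ3_pos : 0 < cLp' * mRp d * 3 ^ (d + 2) * P.S₀3 * P.Vθ := by
  unfold PadicW80Par.cLp'; have := (mR_pos P); have := P.S₀3_pos; have := P.hVθ1; positivity

/-- The denominator of `Lⱼ` is positive. [folklore] -/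
theorem den_L3_pos (j : Fin d) : 0 < cLp' * mRp d * 3 ^ (d + 2) * P.S₀3 * P.V j := by
  unfold PadicW80Par.cLp'; have := (mR_pos P); have := P.S₀3_pos; have := P.hV j; positivity

/-- `L_θ ≤ U/(c_L' m 3^{m+1} S₀ V_θ)`. [folklore] -/
theorem Lθ3_le : (P.Lθ3 : ℝ) ≤ P.Uℓ / (cLp' * mRp d * 3 ^ (d + 2) * P.S₀3 * P.Vθ) := by
  unfold Lθ3
  exact Nat.floor_le (div_nonneg P.U_pos.le P.den_Lθ3_pos.le)

/-- `Lⱼ ≤ U/(c_L' m 3^{m+1} S₀ Vⱼ)`. [folklore] -/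
theorem L3_le (j : Fin d) : (P.L3 j : ℝ) ≤ P.Uℓ / (cLp' * mRp d * 3 ^ (d + 2) * P.S₀3 * P.V j) := by
  unfold L3
  exact Nat.floor_le (div_nonneg P.U_pos.le (P.den_L3_pos j).le)

/-- `U/(c_L' m 3^{m+1} S₀ V_θ) ≥ 2`. [folklore] -/
theorem two_le_U_div_Lθ3den : (2 : ℝ) ≤ P.Uℓ / (cLp' * mRp d * 3 ^ (d + 2) * P.S₀3 * P.Vθ) := by
  rw [le_div_iff₀ P.den_Lθ3_pos]
  have h := P.𝔘3_ge
  rw [P.U_eq3]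
  have hS := P.S₀3_le
  have hm := (two_le_mR P)
  have hG : 1 ≤ P.nGℓ := P.one_le_nG
  have hVθ := P.one_le_nVθ
  have hW := P.one_le_Wstar
  have hV1 : 1 ≤ ∏ j, P.nV j := P.one_le_prodnV
  have hℓ := P.ℓ_pos
  -- `S₀ V_θ ≤ 3 c_S m nW⋆ · ℓ nV_θ = 3 c_S m W⋆ nV_θ`
  have hSV : (P.S₀3 : ℝ) * P.Vθ ≤ 3 * (cSp * mRp d * P.Wstarℓ) * P.nVθ := by
    rw [P.Vθ_eq]
    calc (P.S₀3 : ℝ) * (P.ℓ * P.nVθ) ≤ 3 * (cSp * mRp d * P.nWstarℓ) * (P.ℓ * P.nVθ) := by gcongr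
      _ = 3 * (cSp * mRp d * (P.ℓ * P.nWstarℓ)) * P.nVθ := by ring
      _ = 3 * (cSp * mRp d * P.Wstarℓ) * P.nVθ := by rw [← P.Wstar_eq]
  unfold cLp' cSp at *
  have hmm : mRp d * mRp d ≤ 2 ^ (2 * (d + 1)) := by
    have hmle : mRp d ≤ 2 ^ (d + 1) := by
      unfold mRp
      have : ((d : ℝ) + 1) = ((d + 1 : ℕ) : ℝ) := by push_cast; ring
      rw [this]; exact_mod_cast (Nat.lt_two_pow_self).le
    calc mRp d * mRp d ≤ 2 ^ (d + 1) * 2 ^ (d + 1) := mul_le_mul hmle hmle (mR_pos P).le (by positivity)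
      _ = 2 ^ (2 * (d + 1)) := by rw [← pow_add]; ring_nf
  calc 2 * (2 ^ 12 * mRp d * 3 ^ (d + 2) * (P.S₀3 : ℝ) * P.Vθ)
      = 2 * (2 ^ 12 * mRp d * 3 ^ (d + 2)) * ((P.S₀3 : ℝ) * P.Vθ) := by ring
    _ ≤ 2 * (2 ^ 12 * mRp d * 3 ^ (d + 2)) * (3 * (2 ^ 15 * mRp d * P.Wstarℓ) * P.nVθ) := by gcongr
    _ = 9 * 2 ^ 28 * (mRp d * mRp d) * (3 ^ (d + 1) * P.Wstarℓ * P.nVθ) := by rw [pow_succ]; ring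
    _ ≤ 2 ^ 32 * 2 ^ (2 * (d + 1)) * (3 ^ (d + 1) * P.Wstarℓ * P.nVθ) := by gcongr; norm_num
    _ = 3 ^ (d + 1) * (2 ^ (32 + 2 * (d + 1)) * 1 * 1 * P.nVθ * P.Wstarℓ) := by rw [pow_add]; ring
    _ ≤ 3 ^ (d + 1) * (2 ^ (48 * (d + 1)) * P.nGℓ * (∏ j, P.nV j) * P.nVθ * P.Wstarℓ) := by
        have hG0 : 0 ≤ P.nGℓ := by linarith
        have hpow : (2 : ℝ) ^ (32 + 2 * (d + 1)) ≤ 2 ^ (48 * (d + 1)) :=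
          pow_le_pow_right₀ (by norm_num) (by omega)
        gcongr
    _ = 3 ^ (d + 1) * (2 ^ (48 * (d + 1)) * P.nGℓ * ((∏ j, P.nV j) * P.nVθ) * P.Wstarℓ) := by ring
    _ ≤ 3 ^ (d + 1) * P.𝔘3 := by gcongr

/-- `U/(2 c_L' m 3^{m+1} S₀ V_θ) ≤ L_θ`. [folklore] -/
theorem Lθ3_ge : P.Uℓ / (cLp' * mRp d * 3 ^ (d + 2) * P.S₀3 * P.Vθ) / 2 ≤ P.Lθ3 := by
  unfold Lθ3
  have h1 := Nat.lt_floor_add_one (P.Uℓ / (cLp' * mRp d * 3 ^ (d + 2) * P.S₀3 * P.Vθ))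
  have h2 := P.two_le_U_div_Lθ3den
  linarith

/-- `1 ≤ L_θ`. [folklore] -/
theorem one_le_Lθ3 : 1 ≤ P.Lθ3 := by
  have h := P.Lθ3_ge
  have h2 := P.two_le_U_div_Lθ3den
  have : (1 : ℝ) ≤ P.Lθ3 := by linarith
  exact_mod_cast this

/-- `L_θ < 3^{J₀}`. [folklore] -/
theorem Lθ3_lt_three_pow : P.Lθ3 < 3 ^ P.J₀3 := Nat.lt_pow_succ_log_self (by norm_num) _

/-- `3^{J₀} ≤ 3 L_θ`. [folklore] -/
theorem three_pow_le : 3 ^ P.J₀3 ≤ 3 * P.Lθ3 := by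
  unfold J₀3
  rw [pow_succ]
  have := Nat.pow_log_le_self 3 (show P.Lθ3 ≠ 0 by have := P.one_le_Lθ3; omega)
  omega

/-- `1 ≤ J₀`. [folklore] -/
theorem one_le_J₀3 : 1 ≤ P.J₀3 := Nat.le_add_left 1 _

/-- **`T ≥ 2¹¹ m² nV_θ L_θ`** (indeed `T/L_θ ≈ 9 c_L' c_S m² nV_θ/c_T`): the derivatives outnumber the smallest
exponent range — the source of the room in the numerical conditions and of `t_J ≥ 1`.
[cite: Waldschmidt1980, (3.10) and (3.14) (p. 265)] [cite: Yu1990, (2.31) (p. 36)] -/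
theorem T3_ge_Lθ3 : (2 : ℝ) ^ 11 * mRp d ^ 2 * P.nVθ * P.Lθ3 ≤ P.T3 := by
  have hT := P.T3_ge
  have hL := P.Lθ3_le
  have hS := P.S₀3_ge
  have hm := (mR_pos P)
  have hVθ := P.one_le_nVθ
  have hW := P.one_le_Wstar
  have hU := P.U_pos
  have hℓ := P.ℓ_pos
  refine le_trans ?_ hT
  unfold cTp cLp' cSp at *
  have hden : 0 < (2 : ℝ) ^ 12 * mRp d * 3 ^ (d + 2) * P.S₀3 * P.Vθ := by
    have := P.S₀3_pos; have := P.hVθ1; positivity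
  have hSℓ : 2 * (2 ^ 15 * mRp d * P.Wstarℓ) ≤ (P.S₀3 : ℝ) * P.ℓ := by
    rw [P.Wstar_eq]
    calc 2 * (2 ^ 15 * mRp d * (P.ℓ * P.nWstarℓ)) = (2 * (2 ^ 15 * mRp d * P.nWstarℓ)) * P.ℓ := by ring
      _ ≤ (P.S₀3 : ℝ) * P.ℓ := by gcongr
  calc (2 : ℝ) ^ 11 * mRp d ^ 2 * P.nVθ * P.Lθ3
      ≤ 2 ^ 11 * mRp d ^ 2 * P.nVθ * (P.Uℓ / (2 ^ 12 * mRp d * 3 ^ (d + 2) * P.S₀3 * P.Vθ)) := by gcongr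
    _ = P.Uℓ * (mRp d / (2 * 3 ^ (d + 2) * (P.S₀3 * P.ℓ))) := by
        rw [P.Vθ_eq]; field_simp
    _ ≤ P.Uℓ * (mRp d / (2 * 3 ^ (d + 2) * (2 * (2 ^ 15 * mRp d * P.Wstarℓ)))) := by
        apply mul_le_mul_of_nonneg_left _ hU.le
        apply div_le_div_of_nonneg_left hm.le (by positivity)
        gcongr
    _ = P.Uℓ / (3 * 2 ^ 16 * 3 ^ (d + 1) * P.Wstarℓ) / 2 := by rw [pow_succ]; field_simp
    _ ≤ P.Uℓ / (2 ^ 14 * 3 ^ (d + 1) * P.Wstarℓ) / 2 := by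
        gcongr; norm_num

end PadicW80ParL

end Summit.ABC.StewartYu

end
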